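import Literature.NumberTheory.Automorphic.RankinSelbergTowerFinitenessGauss
import Literature.NumberTheory.Automorphic.AdelicVectorHeightCompact
import Literature.NumberTheory.Automorphic.RankinSelbergTorusEulerExact
import Literature.NumberTheory.Automorphic.DirichletApproximationInfiniteAdele
import Literature.NumberTheory.Automorphic.UnitIdeleArchPushforward
import HarnessLib

/-!
# The Schwartz factor of the `GL_2` torus integrand on the maximal compact subgroup

Topic `NumberTheory/Automorphic`; namespace `Literature.NumberTheory.Automorphic`. Theorems only; part of
the plumbing of the Kirillov `L²`-bound into the bad-place Rankin–Selberg torus integral at `s = 1`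
(the `n ≤ 2` case of the named fact `JacquetShalika1981_partialPairL_pole_of_eq_conj`). The Schwartz
factor `Φ(e_2 diag(a) k)`, `Φ = Φ_∞^{Gauss} ⊗ 𝟙_{𝒪̂²}`, `k ∈ K = K_∞ GL_2(𝒪̂)`, is controlled by the
second torus coordinate `a₁` alone, uniformly in `k`:

* `valued_snd_le_one_of_standardTestFun_lastRow_ne_zero` — `Φ(e_2 diag(a) k) ≠ 0` forces
  `|a₁|_v ≤ 1` at every finite place (`e_2 k` is primitive at `v`);
* `norm_ringEquiv_mixedSpace_le` — `‖ι(y)‖ ≤ R` once `‖y_w‖ ≤ R` for all `w ∣ ∞`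
  (`ι : K_∞ ≅ ℝ^{r₁} × ℂ^{r₂}` is componentwise isometric);
* `standardTestFun_gauss_lastRow_le` (**main**) —
  `Φ(e_2 diag(a) k) ≤ C_K · exp(-‖ι(a_{1,∞})‖ / √2)` with `C_K = e^{‖T⁻¹‖²/4}` the constant of
  `gaussArchTestFun_le_mul_jsArchTestFun` (the archimedean row norms `vecArchNorm` are `K`-invariant,
  `AdelicVectorHeightCompact`).

## References

* H. Jacquet, J. A. Shalika, Amer. J. Math. 103 (1981), §4 [JacquetShalikaAJM1981].
* R. Godement, *Domaines fondamentaux des groupes arithmétiques*, Sém. Bourbaki 257 (1962/63), §1.2.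
-/

noncomputable section

open MeasureTheory NumberField NumberField.InfinitePlace NumberField.InfinitePlace.Completion NumberField.mixedEmbedding IsDedekindDomain Matrix Set
open scoped MatrixGroups NNReal Classical
open Literature.NumberTheory.GaloisRepresentations (ideleGroup)

namespace Literature.NumberTheory.Automorphic

section PhiBound

variable {K : Type} [Field K] [NumberField K]

/-- `lastEntry a = a 1` in rank `2`. [folklore] -/
theorem lastEntry_two (a : Fin 2 → ideleGroup K) : lastEntry a = a 1 := by
  unfold lastEntry
  rw [dif_pos (by norm_num : 0 < 2)]
  rfl

/-- **`Φ(e_2 diag(a) k) ≠ 0` forces `|a₁|_v ≤ 1`** at every finite place, for `k ∈ K`. [folklore] -/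
theorem valued_snd_le_one_of_standardTestFun_lastRow_ne_zero (Φinf : (Fin 2 → InfiniteAdeleRing K) → ℝ)
    {a : Fin 2 → ideleGroup K} (k : ↥(maximalCompactAdelic 2 K))
    (h : standardTestFun 2 K Φinf (lastRow 2 K (glDiagonal 2 (AdeleRing (𝓞 K) K) a *
      (show GL (Fin 2) (AdeleRing (𝓞 K) K) from (k : (AdelicGroupData.gl 2 K).Adelic)))) ≠ 0)
    (v : HeightOneSpectrum (𝓞 K)) :
    Valued.v (((a 1 : ideleGroup K) : AdeleRing (𝓞 K) K).2 v) ≤ 1 := by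
  obtain ⟨j, hj⟩ := exists_valued_lastRow_eq_one (K := K) (v := v) (by norm_num : 0 < 2) k
  have hle := standardTestFun_ne_zero_valued_le_one (v := v) Φinf h j
  rw [lastRow_glDiagonal_mul, lastEntry_two, Pi.smul_apply, smul_eq_mul] at hle
  have e : ((((a 1 : ideleGroup K) : AdeleRing (𝓞 K) K) * lastRow 2 K (show GL (Fin 2) (AdeleRing (𝓞 K) K) from
      (k : (AdelicGroupData.gl 2 K).Adelic)) j).2 v) =
      ((a 1 : ideleGroup K) : AdeleRing (𝓞 K) K).2 v * (lastRow 2 K (show GL (Fin 2) (AdeleRing (𝓞 K) K) from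
        (k : (AdelicGroupData.gl 2 K).Adelic)) j).2 v := rfl
  rw [e, map_mul, hj, mul_one] at hle
  exact hle

/-- **`‖ι(y)‖ ≤ R` once all `‖y_w‖ ≤ R`** (`ι = ringEquiv_mixedSpace` is componentwise isometric). [folklore] -/
theorem norm_ringEquiv_mixedSpace_le (y : InfiniteAdeleRing K) {R : ℝ} (hR : 0 ≤ R) (h : ∀ w, ‖y w‖ ≤ R) :
    ‖InfiniteAdeleRing.ringEquiv_mixedSpace K y‖ ≤ R := by
  refine max_le ?_ ?_
  · refine (pi_norm_le_iff_of_nonneg hR).2 fun w => ?_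
    have h1 : ‖y w.1‖ = ‖(InfiniteAdeleRing.ringEquiv_mixedSpace K y).1 w‖ := by
      rw [InfiniteAdeleRing.ringEquiv_mixedSpace_apply]
      exact ((AddMonoidHomClass.isometry_iff_norm _).1 (isometry_extensionEmbeddingOfIsReal w.2) _).symm
    rw [← h1]; exact h w.1
  · refine (pi_norm_le_iff_of_nonneg hR).2 fun w => ?_
    have h1 : ‖y w.1‖ = ‖(InfiniteAdeleRing.ringEquiv_mixedSpace K y).2 w‖ := by
      rw [InfiniteAdeleRing.ringEquiv_mixedSpace_apply]
      exact ((AddMonoidHomClass.isometry_iff_norm _).1 (isometry_extensionEmbedding w.1) _).symm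
    rw [← h1]; exact h w.1

/-- The archimedean row norm of `e_2` is `1`. [folklore] -/
theorem vecArchNorm_lastBasisVec_two (w : InfinitePlace K) : vecArchNorm K w (lastBasisVec 2 K) = 1 := by
  have h0 : lastBasisVec 2 K 0 = 0 := by simp [lastBasisVec]
  have h1 : lastBasisVec 2 K 1 = 1 := by simp [lastBasisVec]
  rw [vecArchNorm, Fin.sum_univ_two, h0, h1]
  have e0 : ((0 : AdeleRing (𝓞 K) K).1 w) = 0 := rfl
  have e1 : ((1 : AdeleRing (𝓞 K) K).1 w) = 1 := rfl
  rw [e0, e1, nnnorm_zero, nnnorm_one]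
  simp

/-- **The archimedean row norm of `e_2 diag(a) k` at `w` is `‖a_{1,w}‖`** for `k ∈ K`. [folklore] -/
theorem vecArchNorm_lastRow_glDiagonal_mul {a : Fin 2 → ideleGroup K} {k : GL (Fin 2) (AdeleRing (𝓞 K) K)}
    (hk : k ∈ maximalCompactAdelic 2 K) (w : InfinitePlace K) :
    vecArchNorm K w (lastRow 2 K (glDiagonal 2 (AdeleRing (𝓞 K) K) a * k)) = ‖((a 1 : ideleGroup K) : AdeleRing (𝓞 K) K).1 w‖₊ := by
  rw [lastRow_glDiagonal_mul, lastEntry_two, vecArchNorm_smul, lastRow, vecArchNorm_vecMul_of_mem_standardMaximalCompactGL hk,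
    vecArchNorm_lastBasisVec_two, mul_one]

/-- `vecArchNorm_w x ≤ √2 ‖x_∞‖` in rank `2`. [folklore] -/
theorem vecArchNorm_le_sqrt_two_mul_norm_vecInfinitePart (w : InfinitePlace K) (x : Fin 2 → AdeleRing (𝓞 K) K) :
    (vecArchNorm K w x : ℝ) ≤ Real.sqrt 2 * ‖vecInfinitePart K 2 x‖ := by
  have hi : ∀ i, ‖(x i).1 w‖ ≤ ‖vecInfinitePart K 2 x‖ := fun i =>
    (norm_apply_le_norm_ringEquiv_mixedSpace K (x i).1 w).trans (norm_le_pi_norm (vecInfinitePart K 2 x) i)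
  rw [vecArchNorm, Real.coe_sqrt, NNReal.coe_sum, Fin.sum_univ_two]
  simp only [NNReal.coe_pow, coe_nnnorm]
  have h0 := hi 0
  have h1 := hi 1
  have hn : 0 ≤ ‖vecInfinitePart K 2 x‖ := norm_nonneg _
  calc Real.sqrt (‖(x 0).1 w‖ ^ 2 + ‖(x 1).1 w‖ ^ 2) ≤ Real.sqrt (2 * ‖vecInfinitePart K 2 x‖ ^ 2) := by
        refine Real.sqrt_le_sqrt ?_
        nlinarith [norm_nonneg ((x 0).1 w), norm_nonneg ((x 1).1 w)]
    _ = Real.sqrt 2 * ‖vecInfinitePart K 2 x‖ := by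
        rw [Real.sqrt_mul (by norm_num : (0 : ℝ) ≤ 2), Real.sqrt_sq hn]

variable (K) in
/-- The constant `C_K = e^{‖T⁻¹‖²/4}` of `gaussArchTestFun_le_mul_jsArchTestFun` in rank `2`. [folklore] -/
def gaussJsConst : ℝ :=
  Real.exp (‖((toEuclidean (E := Fin 2 → mixedSpace K)).symm :
    EuclideanSpace ℝ (Fin (Module.finrank ℝ (Fin 2 → mixedSpace K))) →L[ℝ] (Fin 2 → mixedSpace K))‖ ^ 2 / 4)

/-- `C_K > 0`. [folklore] -/
theorem gaussJsConst_pos : 0 < gaussJsConst K := Real.exp_pos _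

/-- **The Schwartz factor on `K` is controlled by `a_{1,∞}`**:
`Φ(e_2 diag(a) k) ≤ C_K exp(-‖ι(a_{1,∞})‖/√2)` for `k ∈ K`, `Φ = Φ_∞^{Gauss} ⊗ 𝟙_{𝒪̂²}`. [cite: JacquetShalikaAJM1981, §4] -/
theorem standardTestFun_gauss_lastRow_le {a : Fin 2 → ideleGroup K} {k : GL (Fin 2) (AdeleRing (𝓞 K) K)}
    (hk : k ∈ maximalCompactAdelic 2 K) :
    standardTestFun 2 K (gaussArchTestFun 2 K) (lastRow 2 K (glDiagonal 2 (AdeleRing (𝓞 K) K) a * k)) ≤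
      gaussJsConst K * Real.exp (-(‖((archUnitsOfIdele K (a 1) : (mixedSpace K)ˣ) : mixedSpace K)‖ / Real.sqrt 2)) := by
  classical
  set x := lastRow 2 K (glDiagonal 2 (AdeleRing (𝓞 K) K) a * k) with hx
  have hC := gaussJsConst_pos (K := K)
  -- `Φ ≤ C Φ_js`
  have h1 : standardTestFun 2 K (gaussArchTestFun 2 K) x ≤ gaussJsConst K * standardTestFun 2 K (jsArchTestFun 2 K) x := by
    rw [← standardTestFun_const_mul]
    exact standardTestFun_mono (fun z => gaussArchTestFun_le_mul_jsArchTestFun 2 K z) x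
  refine h1.trans (mul_le_mul_of_nonneg_left ?_ hC.le)
  -- `Φ_js ⊗ 𝟙 (x) ≤ exp(-‖x_∞‖) ≤ exp(-‖ι(a_{1,∞})‖/√2)`
  have h2 : standardTestFun 2 K (jsArchTestFun 2 K) x ≤ Real.exp (-‖vecInfinitePart K 2 x‖) := by
    unfold standardTestFun
    split_ifs
    · exact le_rfl
    · exact (Real.exp_pos _).le
  refine h2.trans (Real.exp_le_exp.2 (neg_le_neg ?_))
  rw [div_le_iff₀ (Real.sqrt_pos.2 (by norm_num : (0 : ℝ) < 2)), mul_comm]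
  -- `‖ι(a_{1,∞})‖ ≤ max_w ‖a_{1,w}‖ = max_w vecArchNorm_w x ≤ √2 ‖x_∞‖`
  rw [coe_archUnitsOfIdele]
  refine norm_ringEquiv_mixedSpace_le _ (by positivity) fun w => ?_
  have h3 := vecArchNorm_le_sqrt_two_mul_norm_vecInfinitePart w x
  rw [hx, vecArchNorm_lastRow_glDiagonal_mul hk w, coe_nnnorm] at h3
  exact h3

end PhiBound

end Literature.NumberTheory.Automorphic
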